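import Mathlib
import Literature.AlgebraicGeometry.Resolution.AdicCompletionRegular
import Literature.AlgebraicGeometry.Resolution.FormalFibresRegularProofs
import Summits.ResolutionOfSingularities.ResolutionOfSingularities.Theorems.FrobeniusClosingSteerOrderRaisingPowerSeries
import HarnessLib

/-!
# Crux `Steer` (stmt-ResolutionOfSingularities-16345), chain W4.1, p = 2 σ-residual, HIGH half, B4 —
# order raising in a regular local ring with perfect residue field (lemma C of the B4 plan)

OURS (campaign `res-hironaka`, rung L ★L-G4, slot W4.1; seat res-type-096 g8; lemma «C» of B4 `noHeightOneCarrier_two`,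
res-L0-w41-plan-1 RULING 3, SIZING 2026-08-27T07:59:27Z; replaces the role of no printed item; NOT a statement of the
manuscript under review; AI-produced, weaker than expert review).

* `OrderRaising.mem_map_of_mul_mem_map` — a non-zero-divisor modulo an ideal `I ⊆ R` stays one modulo `I·A` in every
  FLAT `R`-algebra `A` (`Module.Flat.rTensor_preserves_injective_linearMap` + `TensorProduct.quotTensorEquivQuotSMul`);
* `OrderRaising.mem_maximalIdeal_pow_iff_evalₐ` — `x ∈ 𝔪̂ⁿ ⟺ evalₙ x = 0` in the adic completion of a Noetherian
  local ring;
* `OrderRaising.exists_sq_sub_mem_pow_five_of_local_root` — **lemma C**: `R` regular local of characteristic two with perfect residue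
  field (`∀ a ∃ b, a − b² ∈ 𝔪`), `u ∈ 𝔪²` prime, `u ∤ d`, `u² ∣ d² f − a²` ⟹ `f − g² ∈ 𝔪⁵` for some `g ∈ R`.
  Proof: pass to `R̂` (flat, regular, same residue field; `isRegularLocalRing_adicCompletion`), a power series ring
  `κ⟦X₁..X_d⟧` over the residue field by Cohen's structure theorem (`exists_ringEquiv_mvPowerSeries_residueField`,
  coefficient field through the prime field `𝔽₂ ⊆ R̂`), apply the power-series order raising
  (`FrobeniusClosingSteerOrderRaisingPowerSeries.lean`), and descend: `R/𝔪³ = R̂/𝔪̂³` approximates the formal square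
  root by some `g ∈ R`, `(ĝ − g)² ∈ 𝔪̂⁶` in characteristic two, and `𝔪̂⁵ ∩ R = 𝔪⁵`.

[cite: Matsumura1987, Thm. 8.8, Thm. 8.14, Thm. 28.3, Thm. 29.7] [folklore]
-/

noncomputable section

-- `Summit.<S>.<S>.…` duplicates the summit name by design (single-problem summit).
set_option linter.dupNamespace false

open IsLocalRing

namespace Summit.ResolutionOfSingularities.ResolutionOfSingularities.Theorems.SwitchingDichotomy

namespace OrderRaising

open Literature.AlgebraicGeometry.Resolution

universe u

/-! ## Non-zero-divisors modulo an ideal survive flat base change -/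

section Flat

open TensorProduct

/-- **A non-zero-divisor modulo `I` stays a non-zero-divisor modulo `I·A` in a flat `R`-algebra `A`.** If
`d·r ∈ I ⇒ r ∈ I` in `R`, then `d·x ∈ I A ⇒ x ∈ I A` in `A`: multiplication by `d` on `R/I` is injective, hence so is
its base change to `(R/I) ⊗ A ≅ A / I A`. [cite: Matsumura1987, Thm. 7.4] [folklore] -/
theorem mem_map_of_mul_mem_map {R A : Type*} [CommRing R] [CommRing A] [Algebra R A] [Module.Flat R A]
    (I : Ideal R) (d : R) (hd : ∀ r : R, d * r ∈ I → r ∈ I) (x : A)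
    (hx : algebraMap R A d * x ∈ I.map (algebraMap R A)) : x ∈ I.map (algebraMap R A) := by
  classical
  -- multiplication by `d` on `R ⧸ I` is injective
  set φ : (R ⧸ I) →ₗ[R] (R ⧸ I) := d • LinearMap.id with hφ
  have hφinj : Function.Injective φ := by
    intro y z hyz
    obtain ⟨y, rfl⟩ := Ideal.Quotient.mk_surjective y
    obtain ⟨z, rfl⟩ := Ideal.Quotient.mk_surjective z
    simp only [hφ, LinearMap.smul_apply, LinearMap.id_apply] at hyz
    rw [Ideal.Quotient.eq]
    have : d • Ideal.Quotient.mk I (y - z) = 0 := by rw [map_sub, smul_sub, hyz, sub_self]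
    have e1 : d • Ideal.Quotient.mk I (y - z) = Ideal.Quotient.mk I (d * (y - z)) := rfl
    rw [e1, Ideal.Quotient.eq_zero_iff_mem] at this
    exact hd _ this
  -- hence so is `φ ⊗ A = d • id` on `(R ⧸ I) ⊗ A ≅ A ⧸ I • A`
  have hψinj : Function.Injective (φ.rTensor A) := Module.Flat.rTensor_preserves_injective_linearMap φ hφinj
  have hψ : φ.rTensor A = d • LinearMap.id := by
    rw [hφ, LinearMap.rTensor_smul, LinearMap.rTensor_id]
  set e := TensorProduct.quotTensorEquivQuotSMul A I with he
  -- `d • [x] = 0` in `A ⧸ I • ⊤`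
  have hsmul : d • (Submodule.Quotient.mk x : A ⧸ (I • (⊤ : Submodule R A))) = 0 := by
    rw [← Submodule.Quotient.mk_smul, Submodule.Quotient.mk_eq_zero, Ideal.smul_top_eq_map,
      Submodule.restrictScalars_mem, Algebra.smul_def]
    exact hx
  have hzero : (Submodule.Quotient.mk x : A ⧸ (I • (⊤ : Submodule R A))) = 0 := by
    set y := e.symm (Submodule.Quotient.mk x) with hy
    have hy' : e y = Submodule.Quotient.mk x := by rw [hy, LinearEquiv.apply_symm_apply]
    have h1 : (φ.rTensor A) y = 0 := by
      apply e.injective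
      rw [hψ, LinearMap.smul_apply, LinearMap.id_apply, map_smul, hy', hsmul, map_zero]
    have h2 : y = 0 := hψinj (by rw [h1, map_zero])
    rw [← hy', h2, map_zero]
  rw [Submodule.Quotient.mk_eq_zero, Ideal.smul_top_eq_map, Submodule.restrictScalars_mem] at hzero
  exact hzero

end Flat

/-! ## The adic completion of a Noetherian local ring: powers of the maximal ideal -/

section Completion

variable (R : Type u) [CommRing R] [IsLocalRing R] [IsNoetherianRing R]

/-- In the `𝔪`-adic completion `R̂` of a Noetherian local ring, `x ∈ 𝔪̂ⁿ` iff the `n`-th truncation `R̂ → R/𝔪ⁿ`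
kills `x`. [cite: Matsumura1987, Thm. 8.8 and §8 p. 57] [folklore] -/
theorem mem_maximalIdeal_pow_iff_evalₐ (n : ℕ) (x : AdicCompletion (maximalIdeal R) R) :
    x ∈ maximalIdeal (AdicCompletion (maximalIdeal R) R) ^ n ↔ AdicCompletion.evalₐ (maximalIdeal R) n x = 0 := by
  have hfg := (maximalIdeal R).fg_of_isNoetherianRing
  rw [AdicCompletion.maximalIdeal_eq_map, ← Ideal.map_pow, ← Submodule.restrictScalars_mem R,
    ← Ideal.smul_top_eq_map, AdicCompletion.pow_smul_top_eq_ker_eval hfg, LinearMap.mem_ker]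
  have hle : (maximalIdeal R) ^ n • (⊤ : Ideal R) ≤ (maximalIdeal R) ^ n := by
    rw [smul_eq_mul, Ideal.mul_top]
  rw [← AdicCompletion.factor_eval_eq_evalₐ (I := maximalIdeal R) x hle]
  constructor
  · intro h; rw [h, map_zero]
  · intro h
    obtain ⟨z, hz⟩ := Submodule.Quotient.mk_surjective _ (AdicCompletion.eval (maximalIdeal R) R n x)
    rw [← hz] at h ⊢
    change Ideal.Quotient.factor hle (Ideal.Quotient.mk _ z) = 0 at h
    rw [Ideal.Quotient.factor_mk, Ideal.Quotient.eq_zero_iff_mem] at h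
    change (Submodule.Quotient.mk z : R ⧸ ((maximalIdeal R) ^ n • (⊤ : Ideal R))) = 0
    rw [Submodule.Quotient.mk_eq_zero, smul_eq_mul, Ideal.mul_top]
    exact h

/-- An element of `R` lies in `𝔪ⁿ` iff its image in `R̂` lies in `𝔪̂ⁿ` (`𝔪̂ⁿ ∩ R = 𝔪ⁿ`). [cite: Matsumura1987, Thm. 8.11]
[folklore] -/
theorem mem_pow_iff_algebraMap_mem_pow (n : ℕ) (r : R) :
    r ∈ maximalIdeal R ^ n ↔
      algebraMap R (AdicCompletion (maximalIdeal R) R) r ∈ maximalIdeal (AdicCompletion (maximalIdeal R) R) ^ n := by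
  rw [mem_maximalIdeal_pow_iff_evalₐ, AdicCompletion.algebraMap_apply, Algebra.algebraMap_self, RingHom.id_apply,
    AdicCompletion.evalₐ_of, Ideal.Quotient.eq_zero_iff_mem]

/-- Every element of `R̂` is congruent to an element of `R` modulo `𝔪̂ⁿ`. [cite: Matsumura1987, §8 p. 57] [folklore] -/
theorem exists_sub_algebraMap_mem_pow (n : ℕ) (x : AdicCompletion (maximalIdeal R) R) :
    ∃ r : R, x - algebraMap R (AdicCompletion (maximalIdeal R) R) r ∈
      maximalIdeal (AdicCompletion (maximalIdeal R) R) ^ n := by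
  obtain ⟨r, hr⟩ := Ideal.Quotient.mk_surjective (AdicCompletion.evalₐ (maximalIdeal R) n x)
  refine ⟨r, ?_⟩
  rw [mem_maximalIdeal_pow_iff_evalₐ, map_sub, AdicCompletion.algebraMap_apply, Algebra.algebraMap_self,
    RingHom.id_apply, AdicCompletion.evalₐ_of, hr, sub_self]

end Completion

/-! ## Lemma C: order raising in a regular local ring of characteristic two with perfect residue field -/

section Main

variable {R : Type u} [CommRing R] [IsRegularLocalRing R] [CharP R 2]

/-- Transport of the maximal ideal along a ring isomorphism of local rings. [folklore] -/
theorem map_maximalIdeal_of_ringEquiv {A B : Type*} [CommRing A] [CommRing B] [IsLocalRing A] [IsLocalRing B]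
    (e : A ≃+* B) : (maximalIdeal A).map (e : A →+* B) = maximalIdeal B := by
  apply le_antisymm
  · rw [Ideal.map_le_iff_le_comap]
    intro x hx
    rw [Ideal.mem_comap, IsLocalRing.mem_maximalIdeal, mem_nonunits_iff, RingHom.coe_coe, MulEquiv.isUnit_map]
    exact hx
  · intro y hy
    have : y = (e : A →+* B) (e.symm y) := by simp
    rw [this]
    refine Ideal.mem_map_of_mem _ ?_
    rw [IsLocalRing.mem_maximalIdeal, mem_nonunits_iff] at hy ⊢
    intro hu
    exact hy (by simpa using hu.map e)

/-- **Lemma C (order raising).** Let `R` be a regular local ring of characteristic two whose residue field is perfect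
(`∀ a, ∃ b, a − b² ∈ 𝔪`), `u ∈ 𝔪²` a prime element, `d ∉ (u)`, and `u² ∣ d² f − a²` (a LOCAL square root of `f` modulo
`u²`). Then `f − g² ∈ 𝔪⁵` for some `g ∈ R`. [cite: Matsumura1987, Thm. 8.8, Thm. 8.14, Thm. 29.7] [folklore] -/
theorem exists_sq_sub_mem_pow_five_of_local_root (hperf : ∀ a : R, ∃ b : R, a - b ^ 2 ∈ maximalIdeal R)
    {u d f a : R} (hu : Prime u) (hu2 : u ∈ maximalIdeal R ^ 2) (hd : ¬ u ∣ d)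
    (h : u ^ 2 ∣ d ^ 2 * f - a ^ 2) : ∃ g : R, f - g ^ 2 ∈ maximalIdeal R ^ 5 := by
  classical
  haveI := isDomain_of_isRegularLocalRing R
  set Rh := AdicCompletion (maximalIdeal R) R with hRh
  haveI : IsRegularLocalRing Rh := isRegularLocalRing_adicCompletion R
  set alg : R →+* Rh := algebraMap R Rh with halg
  -- characteristic two in `R̂`
  have h2 : (2 : Rh) = 0 := by
    have : alg 2 = 0 := by rw [show (2 : R) = 0 from by exact_mod_cast CharP.cast_eq_zero R 2, map_zero]
    rwa [map_ofNat] at this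
  haveI : CharP Rh 2 := CharTwo.of_one_ne_zero_of_two_eq_zero one_ne_zero h2
  -- the prime field `𝔽₂ ⊆ R̂` and Cohen's structure theorem
  set ι : ZMod 2 →+* Rh := ZMod.castHom (dvd_refl 2) Rh with hι
  haveI : Fact (Nat.Prime 2) := ⟨Nat.prime_two⟩
  have hk₀ : IsField ι.range := by
    have hinj : Function.Injective ι := ι.injective
    have hbij : Function.Bijective ι.rangeRestrict :=
      ⟨fun x y hxy => hinj (congrArg Subtype.val hxy), ι.rangeRestrict_surjective⟩
    exact MulEquiv.isField (Field.toIsField (ZMod 2)) (RingEquiv.ofBijective ι.rangeRestrict hbij).symm.toMulEquiv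
  obtain ⟨e⟩ := exists_ringEquiv_mvPowerSeries_residueField Rh ι.range hk₀
  set κ := ResidueField Rh with hκ
  -- the residue field of `R̂` has characteristic two and is perfect
  haveI : CharP κ 2 := by
    refine CharTwo.of_one_ne_zero_of_two_eq_zero one_ne_zero ?_
    rw [← map_ofNat (residue Rh) 2, h2, map_zero]
  have hkperf : ∀ x : κ, ∃ y : κ, y ^ 2 = x := by
    intro x
    obtain ⟨x₀, rfl⟩ := (AdicCompletion.residueField_map_bijective (R := R)).2 x
    obtain ⟨r, rfl⟩ := residue_surjective x₀
    obtain ⟨b, hb⟩ := hperf r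
    refine ⟨ResidueField.map alg (residue R b), ?_⟩
    rw [← map_pow, ← map_pow]
    congr 1
    rw [eq_comm, ← sub_eq_zero, ← map_sub, residue_eq_zero_iff]
    exact hb
  -- the data in `S = κ⟦X⟧`
  obtain ⟨m, hm⟩ := h
  set E : R →+* MvPowerSeries (Fin (maximalIdeal Rh).spanFinrank) κ := (e : Rh →+* _).comp alg with hE
  have hmax : (maximalIdeal Rh).map (e : Rh →+* _) =
      maximalIdeal (MvPowerSeries (Fin (maximalIdeal Rh).spanFinrank) κ) := map_maximalIdeal_of_ringEquiv e
  have hpow : ∀ (n : ℕ) (x : Rh), x ∈ maximalIdeal Rh ^ n ↔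
      e x ∈ maximalIdeal (MvPowerSeries (Fin (maximalIdeal Rh).spanFinrank) κ) ^ n := by
    intro n x
    rw [← hmax, ← Ideal.map_pow]
    constructor
    · intro hx; exact Ideal.mem_map_of_mem _ hx
    · intro hx
      have := Ideal.mem_map_of_mem (e.symm : _ →+* Rh) hx
      rw [Ideal.map_of_equiv] at this
      simpa using this
  have hu_S : E u ∈ maximalIdeal (MvPowerSeries (Fin (maximalIdeal Rh).spanFinrank) κ) ^ 2 := by
    rw [hE, RingHom.comp_apply]
    exact (hpow 2 _).mp ((mem_pow_iff_algebraMap_mem_pow R 2 u).mp hu2)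
  have hnzd_Rh : ∀ G : Rh, alg u ∣ alg d * G → alg u ∣ G := by
    intro G hG
    have hI : ∀ r : R, d * r ∈ Ideal.span {u} → r ∈ Ideal.span {u} := by
      intro r hr
      rw [Ideal.mem_span_singleton] at hr ⊢
      rcases hu.dvd_or_dvd hr with h1 | h1
      · exact absurd h1 hd
      · exact h1
    have hmem : alg d * G ∈ (Ideal.span {u}).map alg := by
      rw [Ideal.map_span, Set.image_singleton, Ideal.mem_span_singleton]; exact hG
    have := mem_map_of_mul_mem_map (Ideal.span {u}) d hI G hmem
    rwa [Ideal.map_span, Set.image_singleton, Ideal.mem_span_singleton] at this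
  have hnzd_S : ∀ G : MvPowerSeries (Fin (maximalIdeal Rh).spanFinrank) κ, E u ∣ E d * G → E u ∣ G := by
    intro G hG
    have h1 : alg u ∣ alg d * e.symm G := by
      have := map_dvd e.symm hG
      simpa [hE] using this
    have h2 := map_dvd e (hnzd_Rh _ h1)
    simpa [hE] using h2
  have h_S : E d ^ 2 * E f - E a ^ 2 = E u ^ 2 * E m := by
    have := congrArg E hm
    simpa [map_sub, map_mul, map_pow] using this
  obtain ⟨G, hG⟩ := OrderRaising.exists_sq_sub_mem_pow_five hkperf hu_S hnzd_S h_S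
  -- pull the formal square root back to `R̂` and approximate it in `R`
  set Gh : Rh := e.symm G with hGh
  have hGh : alg f - Gh ^ 2 ∈ maximalIdeal Rh ^ 5 := by
    rw [hpow 5]
    simpa [hGh, hE, map_sub, map_pow] using hG
  obtain ⟨g, hg⟩ := exists_sub_algebraMap_mem_pow R 3 Gh
  refine ⟨g, ?_⟩
  have hsq : Gh ^ 2 - alg g ^ 2 ∈ maximalIdeal Rh ^ 5 := by
    rw [OrderRaising.sq_sub_sq]
    have h6 : (Gh - alg g) ^ 2 ∈ maximalIdeal Rh ^ 6 := by
      have := Ideal.pow_mem_pow hg 2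
      rwa [← pow_mul] at this
    exact Ideal.pow_le_pow_right (by norm_num) h6
  have htot : alg (f - g ^ 2) ∈ maximalIdeal Rh ^ 5 := by
    have e1 : alg (f - g ^ 2) = (alg f - Gh ^ 2) + (Gh ^ 2 - alg g ^ 2) := by rw [map_sub, map_pow]; ring
    rw [e1]
    exact Ideal.add_mem _ hGh hsq
  exact (mem_pow_iff_algebraMap_mem_pow R 5 _).mpr htot

end Main

end OrderRaising

end Summit.ResolutionOfSingularities.ResolutionOfSingularities.Theorems.SwitchingDichotomy

end
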